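import Mathlib.Analysis.InnerProductSpace.PiL2
import Mathlib.Analysis.Calculus.ContDiff.Basic
import HarnessLib

/-!
# Stub P1 `stub_iteratedFDeriv_comp_continuousLinearEquiv` for crux `MoebiusLimitExists`
(stmt-CriticalPhenomena-1344), line `Sketch` v22
(lead prover-line-stmt-CriticalPhenomena-1344-c20-0; THEOREM-ONLY, `--supports stmt-CriticalPhenomena-1344`)

**The jet of a function composed with a continuous linear equivalence.**  For every function
`D : (ℝ³)ⁿ → ℝ`, every continuous linear equivalence `g` of the configuration space `(ℝ³)ⁿ`, every
point `x` and every tuple of directions `m`, the `k`-th iterated Fréchet derivative of `D ∘ g` at `x`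
evaluated on `m` equals the `k`-th iterated Fréchet derivative of `D` at `g x` evaluated on the
transported directions `(g (m j))ⱼ`.  No differentiability hypothesis is needed: both sides are
compatible junk values when `D` is not smooth (Mathlib's
`ContinuousLinearEquiv.iteratedFDerivWithin_comp_right`, specialised to `s = univ`).

Proof: `ContinuousLinearEquiv.iteratedFDerivWithin_comp_right g D uniqueDiffOn_univ _ k` gives
`iteratedFDerivWithin ℝ k (D ∘ g) (g ⁻¹' univ) x = (iteratedFDerivWithin ℝ k D univ (g x)).compContinuousLinearMap (fun _ => g)`;
rewrite `g ⁻¹' univ = univ` and `iteratedFDerivWithin_univ` on both sides and evaluate at `m` with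
`ContinuousMultilinearMap.compContinuousLinearMap_apply`.  Pure calculus, Mathlib only; no
definitions are introduced.
-/

noncomputable section

namespace Summit.CriticalPhenomena.Ising3DConformalLimit.MoebiusLimitExistsSketchV22

/-- **Stub P1 — the jet of a function composed with a continuous linear equivalence.**  For every
function `D` on the configuration space `(ℝ³)ⁿ` and every continuous linear equivalence `g` of it,
the `k`-th iterated Fréchet derivative of `D ∘ g` at `x` is the `k`-th iterated derivative of `D` at
`g x` evaluated on the transported directions (`ContinuousLinearEquiv.iteratedFDerivWithin_comp_right`
with `s = univ`; no differentiability hypothesis). [folklore] -/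
theorem stub_iteratedFDeriv_comp_continuousLinearEquiv : ∀ (n k : ℕ) (D : (Fin n → EuclideanSpace ℝ (Fin 3)) → ℝ)
    (g : (Fin n → EuclideanSpace ℝ (Fin 3)) ≃L[ℝ] (Fin n → EuclideanSpace ℝ (Fin 3)))
    (x : Fin n → EuclideanSpace ℝ (Fin 3)) (m : Fin k → Fin n → EuclideanSpace ℝ (Fin 3)),
    iteratedFDeriv ℝ k (D ∘ g) x m = iteratedFDeriv ℝ k D (g x) (fun j => g (m j)) := by
  intro n k D g x m
  have h := g.iteratedFDerivWithin_comp_right D uniqueDiffOn_univ (Set.mem_univ (g x)) k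
  simp only [Set.preimage_univ, iteratedFDerivWithin_univ] at h
  rw [h, ContinuousMultilinearMap.compContinuousLinearMap_apply]
  rfl

end Summit.CriticalPhenomena.Ising3DConformalLimit.MoebiusLimitExistsSketchV22

end
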